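import Mathlib.Topology.Algebra.Category.ProfiniteGrp.Completion
import Mathlib.CategoryTheory.Action.Continuous
import Mathlib.CategoryTheory.Action.Concrete
import Mathlib.Topology.Category.FinTopCat
import HarnessLib

/-!
# Finite `G`-sets are continuous finite `Ĝ`-sets: `Action FintypeCat G ≌ ContAction FintypeCat Ĝ`

Topic `Literature/GroupTheory` — step 2 of the topological Galois correspondence for covering
spaces (abc-iut cell, campaign-L R1, GAP row G-L4t14-R1): the junction between the category of
FINITE `π₁(X, x₀)`-sets (the target of `CovFin.fibreFunctor`, `Literature/Topology/CoveringSpaces/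
CoveringGaloisCorrespondenceFinite.lean`) and Mochizuki's `B(Π)` = finite sets with a CONTINUOUS
action of a PROFINITE group (the tree's `BCat Π = ContAction FintypeCat Π`, [FrdI] §0 p. 13), for
`Π := Ĝ` the profinite completion (Mathlib `ProfiniteGrp.ProfiniteCompletion.completion`; Ribes–
Zalesskii §3.2).  Classical statement (Ribes–Zalesskii, *Profinite Groups*, §3.2, universal
property of `Ĝ`; SGA 1 XII Cor. 5.2 «`π₁^ét = π₁^top^∧`» at the level of finite sets): an action of a (discrete) group `G` on a
finite set `S` has a finite-index normal kernel, hence extends UNIQUELY to a continuous action of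
`Ĝ`, and every continuous action of `Ĝ` on a finite discrete set arises this way.

* `actionKer S : FiniteIndexNormalSubgroup G` — the kernel of `G → Perm S`;
* `completionSMul`: the action `x • s := (x mod N_S) • s` of `Ĝ` on `S`; a `MulAction`
  (`completionMulAction`), continuous for the discrete topology (`continuousSMul_completion`),
  extending the `G`-action along `η : G → Ĝ` (`completionSMul_eta`), and determined by that
  property (`smul_eq_completionSMul_of_forall_eta`: a continuous `Ĝ`-action on a finite discrete set
  is determined by its restriction to the dense image of `η`);
* `extend : Action FintypeCat G ⥤ ContAction FintypeCat Ĝ`, `restrict : ContAction FintypeCat Ĝ ⥤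
  Action FintypeCat G` (Mathlib `Action.res` along `η`) and **`equivalence : Action FintypeCat G ≌
  ContAction FintypeCat Ĝ`** with `restrict ⋙ extend` and `extend ⋙ restrict` the identity ON
  OBJECTS' carriers.

Everything is proved; no instances are declared globally (the `Ĝ`-action is a `def` used with
`letI`); no named facts.

## References

* L. Ribes, P. Zalesskii, *Profinite Groups*, 2nd ed., Springer 2010, §3.2 (profinite completion
  and its universal property: homomorphisms to (pro)finite groups factor through `Ĝ`).
  [RibesZalesskii2010]
* A. Grothendieck, M. Raynaud, SGA 1, Exp. V §5, Exp. XII Cor. 5.2.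
* S. Mochizuki, *The geometry of Frobenioids I*, §0 p. 13 (`B(Π)`). [MochizukiFrdI2008]
-/

noncomputable section

open CategoryTheory MulAction ProfiniteGrp.ProfiniteCompletion
open scoped FintypeCatDiscrete

universe u

namespace Literature.GroupTheory

namespace FiniteActionCompletion

variable {G : Type u} [Group G]

/-- The profinite completion `Ĝ` of `G` (Mathlib's, as a type with its group and topology).
[cite: RibesZalesskii2010, §3.2] -/
abbrev Ghat (G : Type u) [Group G] : Type u := completion (GrpCat.of G)

/-- `η : G → Ĝ` (Mathlib `etaFn`). [cite: RibesZalesskii2010, §3.2] -/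
abbrev eta (g : G) : Ghat G := etaFn (GrpCat.of G) g

/-! ### The kernel of a finite action and the extended action of `Ĝ` -/

section Kernel

variable (G) (S : Type u) [MulAction G S] [Finite S]

/-- **The kernel `N_S` of the action of `G` on a finite set `S`** is a normal subgroup of finite
index (`G ⧸ N_S ↪ Perm S`). [cite: RibesZalesskii2010, §3.2] -/
abbrev actionKer : FiniteIndexNormalSubgroup G where
  toSubgroup := (MulAction.toPermHom G S).ker

/-- `g ∈ N_S ↔ g` acts trivially. [cite: RibesZalesskii2010, §3.2] -/
theorem mem_actionKer_iff (g : G) : g ∈ (actionKer G S).toSubgroup ↔ ∀ s : S, g • s = s := by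
  change g ∈ (MulAction.toPermHom G S).ker ↔ _
  rw [MonoidHom.mem_ker]
  constructor
  · intro h s
    have := congrArg (fun σ : Equiv.Perm S ↦ σ s) h
    simpa using this
  · intro h
    ext s
    simpa using h s

variable {G S}

/-- The action of `G ⧸ N_S` on `S` (through `G ⧸ N_S →* Perm S`). [cite: RibesZalesskii2010, §3.2] -/
def quotSMul (q : G ⧸ (actionKer G S).toSubgroup) (s : S) : S :=
  QuotientGroup.kerLift (MulAction.toPermHom G S) q s

/-- On classes of elements the quotient action is the action. [cite: RibesZalesskii2010, §3.2] -/
@[simp] theorem quotSMul_mk (g : G) (s : S) :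
    quotSMul (QuotientGroup.mk g : G ⧸ (actionKer G S).toSubgroup) s = g • s := by
  change (QuotientGroup.kerLift (MulAction.toPermHom G S)) (QuotientGroup.mk g) s = g • s
  rw [QuotientGroup.kerLift_mk]
  rfl

/-- **The action of `Ĝ` on `S`**: `x • s := (x_{N_S}) • s`, the component of `x ∈ Ĝ = lim G⧸N` at
the finite-index normal subgroup `N_S` acting through `G ⧸ N_S →* Perm S`.
[cite: RibesZalesskii2010, §3.2] -/
def completionSMul (x : Ghat G) (s : S) : S := quotSMul (x.1 (actionKer G S)) s

/-- **The `Ĝ`-action extends the `G`-action**: `η(g) • s = g • s`. [cite: RibesZalesskii2010, §3.2] -/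
@[simp] theorem completionSMul_eta (g : G) (s : S) : completionSMul (eta g) s = g • s :=
  quotSMul_mk g s

/-- The `Ĝ`-action as a `MulAction` (a `def`, to be used with `letI`).
[cite: RibesZalesskii2010, §3.2] -/
@[reducible] def completionMulAction : MulAction (Ghat G) S where
  smul := completionSMul
  one_smul s := by
    change quotSMul ((1 : Ghat G).1 (actionKer G S)) s = s
    have : (1 : Ghat G).1 (actionKer G S) = (QuotientGroup.mk 1 : G ⧸ (actionKer G S).toSubgroup) :=
      rfl
    rw [this, quotSMul_mk, one_smul]
  mul_smul x y s := by
    change QuotientGroup.kerLift (MulAction.toPermHom G S) ((x * y).1 (actionKer G S)) s =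
      QuotientGroup.kerLift (MulAction.toPermHom G S) (x.1 (actionKer G S))
        (QuotientGroup.kerLift (MulAction.toPermHom G S) (y.1 (actionKer G S)) s)
    have key : ∀ a b : G ⧸ (actionKer G S).toSubgroup,
        QuotientGroup.kerLift (MulAction.toPermHom G S) (a * b) s =
          QuotientGroup.kerLift (MulAction.toPermHom G S) a
            (QuotientGroup.kerLift (MulAction.toPermHom G S) b s) := by
      intro a b
      rw [map_mul]
      rfl
    exact key (x.1 (actionKer G S)) (y.1 (actionKer G S))

/-- The component at a SMALLER finite-index normal subgroup `N ≤ N_S` already computes the action: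
if `x_N = [g]` then `x • s = g • s`. [cite: RibesZalesskii2010, §3.2] -/
theorem completionSMul_eq_of_component_eq {N : FiniteIndexNormalSubgroup G}
    (hN : N ≤ actionKer G S) (x : Ghat G) (g : G) (hx : x.1 N = QuotientGroup.mk g) (s : S) :
    completionSMul x s = g • s := by
  have hcompat : x.1 (actionKer G S) = QuotientGroup.mk g := by
    have h := x.2 (homOfLE hN)
    change (diagram (GrpCat.of G)).map (homOfLE hN) (x.1 N) = x.1 (actionKer G S) at h
    rw [← h, hx]
    rfl
  change quotSMul (x.1 (actionKer G S)) s = g • s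
  rw [hcompat, quotSMul_mk]

/-- Every `x ∈ Ĝ` has, at each `N`, a representative `g ∈ G` of its component; the action of `x` on
`S` is that of any representative of `x_{N_S}`. [cite: RibesZalesskii2010, §3.2] -/
theorem exists_completionSMul_eq (x : Ghat G) : ∃ g : G, ∀ s : S, completionSMul x s = g • s := by
  obtain ⟨g, hg⟩ := QuotientGroup.mk_surjective (x.1 (actionKer G S))
  exact ⟨g, fun s ↦ completionSMul_eq_of_component_eq le_rfl x g hg.symm s⟩

/-- **Continuity**: for the discrete topology on `S`, the `Ĝ`-action is continuous (it factors through
the continuous projection `Ĝ → G ⧸ N_S` to a finite discrete group).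
[cite: RibesZalesskii2010, §3.2] -/
theorem continuousSMul_completion [TopologicalSpace S] [DiscreteTopology S] :
    letI := completionMulAction (G := G) (S := S)
    ContinuousSMul (Ghat G) S := by
  letI := completionMulAction (G := G) (S := S)
  refine ⟨?_⟩
  -- `(x, s) ↦ x • s` factors through `(x_{N_S}, s)`, continuous into a discrete space
  have hπ : Continuous fun x : Ghat G ↦ x.1 (actionKer G S) :=
    (continuous_apply (actionKer G S)).comp continuous_subtype_val
  haveI : DiscreteTopology ((diagram (GrpCat.of G)).obj (actionKer G S)) := ⟨rfl⟩
  have hf : Continuous fun p : ((diagram (GrpCat.of G)).obj (actionKer G S)) × S ↦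
      quotSMul (G := G) (S := S) p.1 p.2 :=
    continuous_of_discreteTopology
  exact hf.comp (hπ.prodMap continuous_id)

/-- **Uniqueness**: a continuous action of `Ĝ` on a finite discrete set is determined by its
restriction along `η` (dense image, Mathlib `denseRange`): if it restricts to the given `G`-action,
it IS `completionSMul`. [cite: RibesZalesskii2010, §3.2] -/
theorem smul_eq_completionSMul_of_forall_eta [TopologicalSpace S] [DiscreteTopology S]
    (μ : MulAction (Ghat G) S) (hμ : @ContinuousSMul (Ghat G) S μ.toSMul _ _)
    (hη : ∀ (g : G) (s : S), @HSMul.hSMul (Ghat G) S S (@instHSMul _ _ μ.toSMul) (eta g) s = g • s)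
    (x : Ghat G) (s : S) :
    @HSMul.hSMul (Ghat G) S S (@instHSMul _ _ μ.toSMul) x s = completionSMul x s := by
  letI := completionMulAction (G := G) (S := S)
  have h₁ : Continuous fun y : Ghat G ↦ @HSMul.hSMul (Ghat G) S S (@instHSMul _ _ μ.toSMul) y s :=
    hμ.continuous_smul.comp (continuous_id.prodMk continuous_const)
  have h₂ : Continuous fun y : Ghat G ↦ completionSMul y s :=
    (continuousSMul_completion (G := G) (S := S)).continuous_smul.comp
      (continuous_id.prodMk continuous_const)
  have := (denseRange (G := GrpCat.of G)).equalizer h₁ h₂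
    (funext fun g ↦ (hη g s).trans (completionSMul_eta g s).symm)
  exact congrFun this x

end Kernel

/-! ### The equivalence `Action FintypeCat G ≌ ContAction FintypeCat Ĝ` -/

section Functors

variable (G)

/-- **Extension of a finite `G`-set to a continuous finite `Ĝ`-set.**
[cite: RibesZalesskii2010, §3.2] -/
def extendObj (A : Action FintypeCat.{u} G) : ContAction FintypeCat.{u} (Ghat G) :=
  letI : MulAction (Ghat G) A.V := completionMulAction (G := G) (S := A.V)
  ⟨Action.FintypeCat.ofMulAction (Ghat G) A.V, continuousSMul_completion (G := G) (S := A.V)⟩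

/-- The carrier of the extension is the carrier. [cite: RibesZalesskii2010, §3.2] -/
@[simp] theorem extendObj_obj_V (A : Action FintypeCat.{u} G) : (extendObj G A).obj.V = A.V := rfl

/-- The extended action is `completionSMul`. [cite: RibesZalesskii2010, §3.2] -/
theorem extendObj_ρ_apply (A : Action FintypeCat.{u} G) (x : Ghat G) (a : A.V) :
    ((extendObj G A).obj.ρ x).hom a = completionSMul (G := G) (S := A.V) x a := rfl

/-- A `G`-map of finite `G`-sets is `Ĝ`-equivariant for the extended actions (choose a common
representative modulo `N_A ⊓ N_B`). [cite: RibesZalesskii2010, §3.2] -/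
theorem map_completionSMul {A B : Action FintypeCat.{u} G} (f : A ⟶ B) (x : Ghat G) (a : A.V) :
    f.hom (completionSMul (G := G) (S := A.V) x a) = completionSMul (G := G) (S := B.V) x (f.hom a) := by
  let N : FiniteIndexNormalSubgroup G := actionKer G A.V ⊓ actionKer G B.V
  obtain ⟨g, hg⟩ := QuotientGroup.mk_surjective (x.1 N)
  rw [completionSMul_eq_of_component_eq (N := N) inf_le_left x g hg.symm a,
    completionSMul_eq_of_component_eq (N := N) inf_le_right x g hg.symm (f.hom a)]
  -- `f` is `G`-equivariant
  exact ConcreteCategory.congr_hom (f.comm g) a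

/-- **The extension functor `Action FintypeCat G ⥤ ContAction FintypeCat Ĝ`** (identity on maps).
[cite: RibesZalesskii2010, §3.2] -/
def extend : Action FintypeCat.{u} G ⥤ ContAction FintypeCat.{u} (Ghat G) where
  obj := extendObj G
  map {A B} f := ObjectProperty.homMk
    { hom := f.hom
      comm := fun x ↦ by
        ext a
        exact map_completionSMul G f x a }
  map_id A := by apply ObjectProperty.hom_ext; rfl
  map_comp f g := by apply ObjectProperty.hom_ext; rfl

/-- `η : G →* Ĝ` as a monoid homomorphism. [cite: RibesZalesskii2010, §3.2] -/
def etaHom : G →* Ghat G := (eta (G := G) |> fun _ ↦ (ProfiniteGrp.ProfiniteCompletion.eta (GrpCat.of G)).hom)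

/-- `etaHom g = η g`. [cite: RibesZalesskii2010, §3.2] -/
@[simp] theorem etaHom_apply (g : G) : etaHom G g = eta g := rfl

/-- **The restriction functor `ContAction FintypeCat Ĝ ⥤ Action FintypeCat G`** along `η`
(forget continuity, then Mathlib `Action.res`). [cite: RibesZalesskii2010, §3.2] -/
def restrict : ContAction FintypeCat.{u} (Ghat G) ⥤ Action FintypeCat.{u} G :=
  ObjectProperty.ι _ ⋙ Action.res _ (etaHom G)

/-- `restrict` then `extend` is the identity on objects: the extended restricted action IS the
original continuous action (uniqueness, `smul_eq_completionSMul_of_forall_eta`).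
[cite: RibesZalesskii2010, §3.2] -/
theorem extendObj_restrict_ρ (B : ContAction FintypeCat.{u} (Ghat G)) (x : Ghat G)
    (b : ((restrict G).obj B).V) :
    ((extendObj G ((restrict G).obj B)).obj.ρ x).hom b = (B.obj.ρ x).hom b := by
  -- the original action is continuous (as a map `Ĝ × S → S`) and restricts to the `G`-action along `η`
  have hc : Continuous fun p : Ghat G × ((restrict G).obj B).V ↦ (B.obj.ρ p.1).hom p.2 :=
    (Action.isContinuous_def _).1 B.property
  let μ : MulAction (Ghat G) ((restrict G).obj B).V := Action.instMulAction B.obj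
  have hμ : @ContinuousSMul (Ghat G) ((restrict G).obj B).V μ.toSMul _ _ := ⟨hc⟩
  exact (smul_eq_completionSMul_of_forall_eta (G := G) (S := ((restrict G).obj B).V) μ hμ
    (fun g s ↦ rfl) x b).symm

/-- `extend` then `restrict` is the identity on objects: restricting the extended action along
`η` gives back the action (`completionSMul_eta`). [cite: RibesZalesskii2010, §3.2] -/
theorem restrict_extendObj_ρ (A : Action FintypeCat.{u} G) (g : G) (a : A.V) :
    (((restrict G).obj (extendObj G A)).ρ g).hom a = (A.ρ g).hom a := by
  change completionSMul (G := G) (S := A.V) (eta g) a = _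
  rw [completionSMul_eta]
  rfl

/-- The unit: `A ≅ restrict (extend A)`, identity on carriers. [cite: RibesZalesskii2010, §3.2] -/
def unitIsoApp (A : Action FintypeCat.{u} G) : A ≅ (extend G ⋙ restrict G).obj A :=
  Action.mkIso (Iso.refl _) fun g ↦ by
    ext a
    exact (restrict_extendObj_ρ G A g a).symm

/-- The counit: `extend (restrict B) ≅ B`, identity on carriers. [cite: RibesZalesskii2010, §3.2] -/
def counitIsoApp (B : ContAction FintypeCat.{u} (Ghat G)) : (restrict G ⋙ extend G).obj B ≅ B :=
  ObjectProperty.isoMk _ (Action.mkIso (Iso.refl _) fun x ↦ by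
    ext b
    exact extendObj_restrict_ρ G B x b)

/-- **THE EQUIVALENCE `Action FintypeCat G ≌ ContAction FintypeCat Ĝ`: finite `G`-sets are the
same as finite sets with a continuous action of the profinite completion** (SGA 1 V 5 / Ribes–
Zalesskii 3.2.6; the junction `FinSet^{π₁(X,x₀)} ≌ B(π̂₁)` for the covering-space Galois
correspondence). [cite: RibesZalesskii2010, §3.2] -/
def equivalence : Action FintypeCat.{u} G ≌ ContAction FintypeCat.{u} (Ghat G) where
  functor := extend G
  inverse := restrict G
  unitIso := NatIso.ofComponents (unitIsoApp G) fun {A B} f ↦ by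
    apply Action.Hom.ext
    rfl
  counitIso := NatIso.ofComponents (counitIsoApp G) fun {A B} f ↦ by
    apply ObjectProperty.hom_ext
    apply Action.Hom.ext
    rfl
  functor_unitIso_comp A := by
    apply ObjectProperty.hom_ext
    apply Action.Hom.ext
    rfl

/-- The functor of the equivalence is `extend`. [cite: RibesZalesskii2010, §3.2] -/
@[simp] theorem equivalence_functor : (equivalence G).functor = extend G := rfl

/-- The inverse of the equivalence is `restrict`. [cite: RibesZalesskii2010, §3.2] -/
@[simp] theorem equivalence_inverse : (equivalence G).inverse = restrict G := rfl

end Functors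

end FiniteActionCompletion

end Literature.GroupTheory

end
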